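import Mathlib.LinearAlgebra.Eigenspace.Minpoly
import Mathlib.Analysis.SpecialFunctions.Pow.Real
import Mathlib.Analysis.Complex.Basic
import Literature.NumberTheory.GaloisRepresentations.WeilDeligneGeneric
import Literature.NumberTheory.GaloisRepresentations.GenericWeilDeligneOrbitProofs
import HarnessLib

/-!
# Pure Weil–Deligne representations (Taylor–Yoshida 2007, §1) and purity ⇒ genericity

Topic `Literature/NumberTheory/GaloisRepresentations`; dot-notation extensions of the accepted
structure `WeilDeligneRep`.

**What is reproduced.** R. Taylor, T. Yoshida, *Compatibility of local and global Langlands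
correspondences*, J. Amer. Math. Soc. **20** (2007), 467–493 (arXiv:math/0412357), §1, p. 471
(arXiv pp. 5–6): `(V, r, N)` is *strictly pure of weight `k ∈ ℝ`* if every eigenvalue `α` of
`r(φ)`, `φ` a lift of the geometric Frobenius, is a Weil `q^k`-number; *mixed* if it has an
increasing filtration `Fil^W_i` whose `i`-th graded piece is strictly pure of weight `i` (then
`N Fil^W_i ⊆ Fil^W_{i-2}`); **pure of weight `k`** if it is mixed with all weights in `k + ℤ` and
for all `i ∈ ℤ_{>0}`, `N^i : gr^W_{k+i} V ⥲ gr^W_{k-i} V`.  Lemma 1.4 (4): *given `(V, r)` with `r`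
semisimple there is, up to equivalence, at most one `N` which makes `(V, r, N)` pure* (proof,
arXiv p. 6: `V = ⊕_i ⊕_{j ≤ i} N^j V(i)`, `V(i) = ker (N^{i+1} : V_i → V_{-i-2})`).

**How it is rendered** (complex coefficients, as everywhere in this topic).  Fix `φ ∈ W_K`; in
the theorems `deg φ = -1`, i.e. `φ` is a geometric Frobenius lift in the sign convention of
`WeilGroup`, under which `WeilDeligneRep.conj_N` reads `r(φ) N = q⁻¹ N r(φ)`.  The *weight-`(k+j)`
space* `V_j = weightSpace r φ k j` is the sum of the generalised eigenspaces of `r(φ)` for the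
eigenvalues `α` with `|α|² = q^{k+j}` (eigenspaces for Frobenius-semisimple `r`: Taylor–Yoshida's
`V_j`).  `Fil^W_{k+i} = ⊕_{j ≤ i} V_j` is the weight filtration, `gr^W_{k+i} ≅ V_i` canonically,
`N V_j ⊆ V_{j-2}`, and the map induced by `N^i` on graded pieces is `N^i|_{V_i} : V_i → V_{-i}`;
so `(V, r, N)` is pure of weight `k` iff `⊕_j V_j = V` (all weights lie in `k + ℤ`) and every
`N^i|_{V_i} : V_i → V_{-i}` is bijective — this is `WeilDeligneRep.IsPure`.  Purity through the
complex absolute value under the fixed coefficient field `ℂ` ("`ι`-pure") is implied by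
Taylor–Yoshida's (all embeddings of `α ∈ ℚ^{ac}`); their proofs use one absolute value only.

## Contents (all definitions have bodies; all lemmas are proved)

* `map_maxGenEigenspace_le_of_mul_eq_smul_mul` (`S T = c • T S` ⇒ `T` maps `V^S_μ` into
  `V^S_{cμ}`) and `gradedLefschetz_eq_zero` (the linear algebra of the proof of Lemma 1.4 (4));
* `weightSpace`, `IsPure` — the definitions [cite: TaylorYoshida2007, §1, p. 471]; sanity value
  `isPure_trivial` (`(1, 0)` is pure of weight `0`);
* `IsPure.isGeneric` — **pure ⇒ generic** (`WeilDeligneRep.IsGeneric`, Allen's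
  `Hom_WD((r,N),(r(1),N)) = 0`): asserted without proof in Allen, Duke Math. J. 165 (2016), §1.2
  ("it is not hard to see that any (mixed) pure Galois representation ... will define a smooth
  point", and smooth points of the local lifting rings are exactly those with generic
  Weil–Deligne representation, loc. cit.); proved here by Taylor–Yoshida's argument for
  Lemma 1.4 (4);
* `IsPure.isEquivalent_of_isGeneric`, `IsPure.isEquivalent` — with the proved orbit theorem
  `AHTW2026_prop_6_0_5_generic_conj_holds` (A'Campo–Hevesi–Thorne–Whitmore, arXiv:2607.11763,
  Prop. 6.0.5): on a fixed Frobenius-semisimple `(V, r)` a pure `N` is equivalent to every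
  generic `N'`, in particular to every pure `N'` — Taylor–Yoshida's Lemma 1.4 (4).

Not here: independence of `φ`, `W_K`-stability of the `V_j`, Lemma 1.4 (1)–(3), (5), (6).

References: Taylor–Yoshida, J. Amer. Math. Soc. 20 (2007), arXiv:math/0412357, §1
[TaylorYoshida2007]; Allen, Duke Math. J. 165 (2016), Def. 1.1.2, §1.2 [Allen2016];
A'Campo–Hevesi–Thorne–Whitmore, arXiv:2607.11763, Prop. 6.0.5 [AHTW2026].
-/
noncomputable section

namespace Literature.NumberTheory.GaloisRepresentations

variable {F : Type*} [Field F] [ValuativeRel F] [TopologicalSpace F] [IsNonarchimedeanLocalField F]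

open GaloisRepresentations.IsNonarchimedeanLocalField WeilGroup

namespace WeilDeligneRep

/-! ### Linear algebra -/

section LinearAlgebra

variable {K : Type*} [Field K] {E : Type*} [AddCommGroup E] [Module K E]

/-- If `S T = c • T S` then `(S - c μ)^n T = c^n • T (S - μ)^n`. [folklore] -/
theorem sub_smul_pow_mul_eq_of_mul_eq_smul_mul {S T : Module.End K E} {c : K}
    (h : S * T = c • (T * S)) (μ : K) (n : ℕ) :
    (S - (c * μ) • (1 : Module.End K E)) ^ n * T =
      c ^ n • (T * (S - μ • (1 : Module.End K E)) ^ n) := by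
  induction n with
  | zero => simp
  | succ n ih =>
    have h1 : (S - (c * μ) • (1 : Module.End K E)) * T =
        c • (T * (S - μ • (1 : Module.End K E))) := by
      rw [sub_mul, mul_sub, smul_sub, h, Algebra.smul_mul_assoc, one_mul, Algebra.mul_smul_comm,
        mul_one, smul_smul]
    rw [pow_succ, mul_assoc, h1, Algebra.mul_smul_comm, ← mul_assoc, ih, Algebra.smul_mul_assoc,
      smul_smul, mul_assoc, ← pow_succ, ← pow_succ']

/-- If `S T = c • T S` then `T` maps the generalised `μ`-eigenspace of `S` into the generalised
`c μ`-eigenspace. [folklore] -/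
theorem map_maxGenEigenspace_le_of_mul_eq_smul_mul {S T : Module.End K E} {c : K}
    (h : S * T = c • (T * S)) (μ : K) :
    (Module.End.maxGenEigenspace S μ).map T ≤ Module.End.maxGenEigenspace S (c * μ) := by
  intro y hy
  rw [Submodule.mem_map] at hy
  obtain ⟨x, hx, rfl⟩ := hy
  rw [Module.End.mem_maxGenEigenspace] at hx ⊢
  obtain ⟨n, hn⟩ := hx
  refine ⟨n, ?_⟩
  have := congrArg (fun A : Module.End K E => A x) (sub_smul_pow_mul_eq_of_mul_eq_smul_mul h μ n)
  simp only [Module.End.mul_apply, LinearMap.smul_apply] at this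
  rw [this, hn, map_zero, smul_zero]

/-- **Graded Lefschetz vanishing** (the linear algebra of Taylor–Yoshida's proof of Lemma 1.4 (4),
arXiv:math/0412357 p. 6): if `W_j = 0` for `j > M`, `N W_j ⊆ W_{j-2}` with `N^i : W_i → W_{-i}`
onto and injective on `W_i` (`i ≥ 0`), and `f` commutes with `N` with `f W_j ⊆ W_{j+2}`, then `f`
vanishes on every `W_j` (descending induction on `j`: for `j = -i < 0` write `x = N^i y`; for
`j = i ≥ 0` write `x = p + N z`, `N^{i+1} p = 0`, `z ∈ W_{i+2}`, so `f p ∈ W_{i+2} ∩ ker N^{i+2}`).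
[cite: TaylorYoshida2007, proof of Lemma 1.4 (4)] -/
theorem gradedLefschetz_eq_zero (W : ℤ → Submodule K E) (N f : E →ₗ[K] E) {M : ℤ}
    (hbdd : ∀ j, M < j → ∀ x ∈ W j, x = 0)
    (hN : ∀ j, ∀ x ∈ W j, N x ∈ W (j - 2))
    (hsurj : ∀ i : ℕ, ∀ x ∈ W (-(i : ℤ)), ∃ y ∈ W (i : ℤ), (N ^ i) y = x)
    (hinj : ∀ i : ℕ, ∀ x ∈ W (i : ℤ), (N ^ i) x = 0 → x = 0)
    (hf : ∀ j, ∀ x ∈ W j, f x ∈ W (j + 2)) (hcomm : ∀ x, f (N x) = N (f x)) :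
    ∀ j, ∀ x ∈ W j, f x = 0 := by
  -- `f` commutes with the powers of `N`, and `N ^ m` lowers the index by `2 m`.
  have hcommpow : ∀ m : ℕ, ∀ x, f ((N ^ m) x) = (N ^ m) (f x) := by
    intro m
    induction m with
    | zero => intro x; simp
    | succ m ih => intro x; rw [pow_succ, Module.End.mul_apply, Module.End.mul_apply, ih, hcomm]
  have hNpow : ∀ m : ℕ, ∀ j, ∀ x ∈ W j, (N ^ m) x ∈ W (j - 2 * m) := by
    intro m
    induction m with
    | zero => intro j x hx; simpa using hx
    | succ m ih =>
      intro j x hx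
      have h1 : (N ^ m) (N x) ∈ W (j - 2 - 2 * m) := ih (j - 2) (N x) (hN j x hx)
      have h2 : j - 2 * ((m + 1 : ℕ) : ℤ) = j - 2 - 2 * m := by push_cast; ring
      rw [pow_succ, Module.End.mul_apply, h2]
      exact h1
  -- The descending induction step.
  have step : ∀ j : ℤ, (∀ j', j < j' → ∀ x ∈ W j', f x = 0) → ∀ x ∈ W j, f x = 0 := by
    intro j IH x hx
    rcases lt_or_ge j 0 with hj | hj
    · obtain ⟨i, rfl⟩ := Int.exists_eq_neg_ofNat hj.le
      obtain ⟨y, hy, rfl⟩ := hsurj i x hx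
      rw [hcommpow, IH i (by omega) y hy, map_zero]
    · obtain ⟨i, rfl⟩ := Int.eq_ofNat_of_zero_le hj
      -- `u = N^{i+1} x ∈ W_{-(i+2)} = N^{i+2} W_{i+2}`
      have hu : (N ^ (i + 1)) x ∈ W (-((i + 2 : ℕ) : ℤ)) := by
        have h1 := hNpow (i + 1) i x hx
        have h2 : (-((i + 2 : ℕ) : ℤ)) = (i : ℤ) - 2 * ((i + 1 : ℕ) : ℤ) := by push_cast; ring
        rw [h2]; exact h1
      obtain ⟨z, hz, hzu⟩ := hsurj (i + 2) _ hu
      have hNz : N z ∈ W (i : ℤ) := by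
        have h1 := hN _ z hz
        have h2 : ((i + 2 : ℕ) : ℤ) - 2 = (i : ℤ) := by push_cast; ring
        rw [h2] at h1; exact h1
      have hp : x - N z ∈ W (i : ℤ) := sub_mem hx hNz
      have hNp : (N ^ (i + 1)) (x - N z) = 0 := by
        rw [map_sub, sub_eq_zero, ← hzu, pow_succ N (i + 1), Module.End.mul_apply]
      have hfz : f z = 0 := IH _ (by push_cast; omega) z hz
      have hfp : f (x - N z) = 0 := by
        refine hinj (i + 2) _ ?_ ?_
        · have h1 := hf _ _ hp
          have h2 : (i : ℤ) + 2 = ((i + 2 : ℕ) : ℤ) := by push_cast; ring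
          rw [h2] at h1; exact h1
        · rw [← hcommpow, pow_succ', Module.End.mul_apply, hNp, map_zero, map_zero]
      calc f x = f (x - N z + N z) := by rw [sub_add_cancel]
        _ = 0 := by rw [map_add, hfp, hcomm, hfz, map_zero, add_zero]
  -- Assemble: by induction on `n`, `f` vanishes on `W_j` for `j > M - n`.
  have main : ∀ n : ℕ, ∀ j : ℤ, M - n < j → ∀ x ∈ W j, f x = 0 := by
    intro n
    induction n with
    | zero => intro j hj x hx; rw [hbdd j (by simpa using hj) x hx, map_zero]
    | succ n ih =>
      intro j hj
      exact step j fun j' hj' => ih j' (by push_cast at hj; omega)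
  intro j
  obtain ⟨n, hn⟩ := exists_nat_gt (M - j)
  exact main n j (by omega)

end LinearAlgebra

/-! ### Pure Weil–Deligne representations -/

variable {V : Type*} [AddCommGroup V] [Module ℂ V]

/-- The **weight-`(k + j)` space** `V_j` of a complex Weil–Deligne representation `r = (ρ, N)`
with respect to `φ ∈ W_F` (a geometric Frobenius lift, `deg φ = -1`): the sum of the generalised
eigenspaces of `ρ(φ)` for the eigenvalues `α` with `|α|² = q^{k+j}` (Taylor–Yoshida's `V_j`,
"strictly pure of weight `k + j`", for Frobenius-semisimple `r`; in general
`Fil^W_{k+i} = ⊕_{j ≤ i} V_j` is their weight filtration and `gr^W_{k+j} ≅ V_j`).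
Ref: Taylor–Yoshida, J. Amer. Math. Soc. 20 (2007), §1, p. 471 (arXiv:math/0412357, pp. 5–6).
[cite: TaylorYoshida2007, §1, p. 471] -/
def weightSpace (r : WeilDeligneRep F ℂ V) (φ : WeilGroup F) (k : ℝ) (j : ℤ) : Submodule ℂ V :=
  ⨆ (α : ℂ) (_ : ‖α‖ ^ 2 = (residueFieldCard F : ℝ) ^ (k + (j : ℝ))),
    Module.End.maxGenEigenspace (r.ρ φ) α

/-- A complex Weil–Deligne representation `r = (ρ, N)` on `V` is **pure of weight `k ∈ ℝ`**
(with respect to the geometric Frobenius lift `φ`) if it is mixed with all weights in `k + ℤ` —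
the weight spaces `V_j` span `V` — and for every `i ≥ 0` the map `N^i : gr^W_{k+i} → gr^W_{k-i}`,
i.e. `N^i|_{V_i} : V_i → V_{-i}`, is bijective (`N^i V_i = V_{-i}` and injective on `V_i`).
Ref: Taylor–Yoshida, J. Amer. Math. Soc. 20 (2007), §1, p. 471, display before Lemma 1.4: "pure
of weight `k` if it is mixed with all weights in `k + ℤ` and if for all `i ∈ ℤ_{>0}`,
`N^i : gr^W_{k+i} V ⥲ gr^W_{k-i} V`". [cite: TaylorYoshida2007, §1, p. 471] -/
def IsPure (r : WeilDeligneRep F ℂ V) (φ : WeilGroup F) (k : ℝ) : Prop :=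
  (⨆ j : ℤ, r.weightSpace φ k j) = ⊤ ∧
    ∀ i : ℕ, (r.weightSpace φ k i).map (r.N ^ i) = r.weightSpace φ k (-(i : ℤ)) ∧
      ∀ x ∈ r.weightSpace φ k i, (r.N ^ i) x = 0 → x = 0

/-- A generalised eigenspace of `ρ(φ)` for an eigenvalue of absolute value `|α|² = q^{k+j}` lies
in the weight space `V_j`. [cite: TaylorYoshida2007, §1, p. 471] -/
theorem maxGenEigenspace_le_weightSpace (r : WeilDeligneRep F ℂ V) (φ : WeilGroup F) (k : ℝ)
    (j : ℤ) {α : ℂ} (hα : ‖α‖ ^ 2 = (residueFieldCard F : ℝ) ^ (k + (j : ℝ))) :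
    Module.End.maxGenEigenspace (r.ρ φ) α ≤ r.weightSpace φ k j :=
  le_iSup₂_of_le (f := fun (α : ℂ) (_ : ‖α‖ ^ 2 = (residueFieldCard F : ℝ) ^ (k + (j : ℝ))) =>
    Module.End.maxGenEigenspace (r.ρ φ) α) α hα le_rfl

/-- If `ρ(φ) T = c • T ρ(φ)` with `|c|² = q^d` then `T` maps `V_j` into `V_{j+d}`: applied to
`T = N` (`c = q⁻¹`, `d = -2`) and to morphisms `T = f : (r,N) → (r(1),N)` (`c = q`, `d = 2`).
[cite: TaylorYoshida2007, §1, p. 471] -/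
theorem map_weightSpace_le_of_comp_eq_smul_comp (r : WeilDeligneRep F ℂ V) (φ : WeilGroup F)
    (k : ℝ) {T : V →ₗ[ℂ] V} {c : ℂ} {d : ℤ} (h : r.ρ φ * T = c • (T * r.ρ φ))
    (hc : ‖c‖ ^ 2 = (residueFieldCard F : ℝ) ^ (d : ℝ)) (j : ℤ) :
    (r.weightSpace φ k j).map T ≤ r.weightSpace φ k (j + d) := by
  have hq : (0 : ℝ) < residueFieldCard F :=
    zero_lt_one.trans (by exact_mod_cast one_lt_residueFieldCard F)
  unfold weightSpace
  rw [Submodule.map_iSup]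
  refine iSup_le fun α => ?_
  rw [Submodule.map_iSup]
  refine iSup_le fun hα => ?_
  refine (map_maxGenEigenspace_le_of_mul_eq_smul_mul h α).trans
    (r.maxGenEigenspace_le_weightSpace φ k (j + d) ?_)
  rw [_root_.norm_mul, mul_pow, hc, hα, ← Real.rpow_add hq]
  congr 1; push_cast; ring

/-- Sanity value: **the trivial representation `(1, 0)` is pure of weight `0`** (any `φ`): its
only weight space is `V_0 = V` (`ρ(φ) = 1` has the single eigenvalue `1 = q^0`) and `N = 0`
(strictly pure representations are pure). [cite: TaylorYoshida2007, §1, p. 471] -/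
theorem isPure_trivial (φ : WeilGroup F) : (trivial (F := F) ℂ V).IsPure φ 0 := by
  have hq1 : (1 : ℝ) < residueFieldCard F := by exact_mod_cast one_lt_residueFieldCard F
  have hρ : (trivial (F := F) ℂ V).ρ φ = (1 : Module.End ℂ V) := by
    simp only [trivial, ofRep_ρ, Representation.trivial, MonoidHom.one_apply]
  have hN0 : (trivial (F := F) ℂ V).N = 0 := by simp only [trivial, ofRep_N]
  -- generalised eigenspaces of the identity
  have hmax1 : Module.End.maxGenEigenspace (1 : Module.End ℂ V) 1 = ⊤ :=
    eq_top_iff.mpr fun x _ => (Module.End.mem_maxGenEigenspace _ _ _).mpr ⟨1, by simp⟩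
  have hmaxne : ∀ α : ℂ, α ≠ 1 → Module.End.maxGenEigenspace (1 : Module.End ℂ V) α = ⊥ := by
    intro α hα
    refine eq_bot_iff.mpr fun x hx => ?_
    obtain ⟨n, hn⟩ := (Module.End.mem_maxGenEigenspace _ _ _).mp hx
    have e : (1 - α • (1 : Module.End ℂ V)) ^ n = (1 - α) ^ n • (1 : Module.End ℂ V) := by
      rw [show (1 - α • (1 : Module.End ℂ V)) = (1 - α) • (1 : Module.End ℂ V) by
        rw [sub_smul, one_smul], smul_pow, one_pow]
    rw [e, LinearMap.smul_apply, Module.End.one_apply, smul_eq_zero] at hn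
    exact (Submodule.mem_bot ℂ).mpr (hn.resolve_left (pow_ne_zero _ (sub_ne_zero.mpr hα.symm)))
  -- the weight spaces: `V_0 = V`, `V_j = 0` for `j ≠ 0`
  have hW0 : (trivial (F := F) ℂ V).weightSpace φ 0 0 = ⊤ := by
    rw [eq_top_iff, ← hmax1]
    refine le_trans (le_of_eq ?_) ((trivial (F := F) ℂ V).maxGenEigenspace_le_weightSpace φ 0 0
      (α := 1) (by simp))
    rw [hρ]
  have hWj : ∀ j : ℤ, j ≠ 0 → (trivial (F := F) ℂ V).weightSpace φ 0 j = ⊥ := by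
    intro j hj
    unfold weightSpace
    rw [hρ, eq_bot_iff]
    refine iSup₂_le fun α hα => (hmaxne α ?_).le
    rintro rfl
    rw [NormOneClass.norm_one, one_pow, zero_add] at hα
    have h1 : (residueFieldCard F : ℝ) ^ ((0 : ℤ) : ℝ) =
        (residueFieldCard F : ℝ) ^ ((j : ℤ) : ℝ) := by
      rw [← hα, Int.cast_zero, Real.rpow_zero]
    have h2 : ((0 : ℤ) : ℝ) = ((j : ℤ) : ℝ) :=
      le_antisymm ((Real.rpow_le_rpow_left_iff hq1).mp h1.le)
        ((Real.rpow_le_rpow_left_iff hq1).mp h1.ge)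
    exact hj (by exact_mod_cast h2.symm)
  refine ⟨?_, fun i => ⟨?_, ?_⟩⟩
  · rw [eq_top_iff, ← hW0]
    exact le_iSup (fun j : ℤ => (trivial (F := F) ℂ V).weightSpace φ 0 j) 0
  · cases i with
    | zero => simp [Module.End.one_eq_id]
    | succ i =>
      rw [hN0, zero_pow (Nat.succ_ne_zero i), Submodule.map_zero, hWj _ (by omega)]
  · intro x hx h0
    cases i with
    | zero => simpa using h0
    | succ i =>
      rw [hWj _ (by omega)] at hx
      exact (Submodule.mem_bot ℂ).mp hx

/-- **Pure ⇒ generic.**  A complex Weil–Deligne representation which is pure of some weight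
(with respect to a geometric Frobenius lift `φ`, `deg φ = -1`) on a finite-dimensional space is
generic in the sense of Allen: `Hom_WD((r,N),(r(1),N)) = 0`.  Proof: a morphism `f` to the twist
satisfies `ρ(φ) f = q f ρ(φ)`, so raises weights by `2`, and commutes with `N`, which lowers
them by `2`; the conditions `N^i : V_i ⥲ V_{-i}` then force `f = 0` (`gradedLefschetz_eq_zero`,
the argument of Taylor–Yoshida's proof of Lemma 1.4 (4)).  Consequently (Taylor–Yoshida,
Lemma 1.4 (3)) `rec` of a tempered representation is generic, and for the Galois side purity is
a sufficient condition for hypothesis (e) of A'Campo, IMRN 2024, Thm 1.0.1.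
[folklore] (corollary of [cite: TaylorYoshida2007, proof of Lemma 1.4 (4)]) -/
theorem IsPure.isGeneric [FiniteDimensional ℂ V] {r : WeilDeligneRep F ℂ V} {φ : WeilGroup F}
    (hφ : deg φ = -1) {k : ℝ} (h : r.IsPure φ k) : r.IsGeneric := by
  classical
  intro f hfρ hfN
  obtain ⟨htop, hL⟩ := h
  have hq1 : (1 : ℝ) < residueFieldCard F := by exact_mod_cast one_lt_residueFieldCard F
  have hq0 : (0 : ℝ) < residueFieldCard F := zero_lt_one.trans hq1
  have hqC : (residueFieldCard F : ℂ) ≠ 0 := by exact_mod_cast (residueFieldCard_ne_zero F)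
  have hnormq : ‖(residueFieldCard F : ℂ)‖ = (residueFieldCard F : ℝ) := Complex.norm_natCast _
  -- at `φ`: `ρ(φ) N = q⁻¹ N ρ(φ)` (Weil–Deligne relation), `ρ(φ) f = q f ρ(φ)` (twist)
  have hN : r.ρ φ * r.N = (residueFieldCard F : ℂ)⁻¹ • (r.N * r.ρ φ) := by
    simp only [Module.End.mul_eq_comp]
    rw [r.conj_N φ, hφ, zpow_neg, zpow_one]
  have hf : r.ρ φ * f = (residueFieldCard F : ℂ) • (f * r.ρ φ) := by
    have h1 : f * r.ρ φ = (residueFieldCard F : ℂ)⁻¹ • (r.ρ φ * f) := by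
      simp only [Module.End.mul_eq_comp]
      rw [hfρ φ, hφ, zpow_neg, zpow_one]
    rw [h1, smul_smul, mul_inv_cancel₀ hqC, one_smul]
  have hcN : ‖(residueFieldCard F : ℂ)⁻¹‖ ^ 2 = (residueFieldCard F : ℝ) ^ ((-2 : ℤ) : ℝ) := by
    rw [_root_.norm_inv, hnormq, inv_pow, ← Real.rpow_natCast, ← Real.rpow_neg hq0.le]; norm_num
  have hcf : ‖(residueFieldCard F : ℂ)‖ ^ 2 = (residueFieldCard F : ℝ) ^ ((2 : ℤ) : ℝ) := by
    rw [hnormq, ← Real.rpow_natCast]; norm_num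
  -- finitely many weights occur
  have hfinE : Set.Finite {α : ℂ | Module.End.maxGenEigenspace (r.ρ φ) α ≠ ⊥} := by
    refine (Module.End.finite_hasEigenvalue (r.ρ φ)).subset ?_
    intro α hα
    exact (Module.End.hasUnifEigenvalue_iff_hasUnifEigenvalue_one ENat.top_pos).mp hα
  have hfinJ : Set.Finite {j : ℤ | ∃ α : ℂ, Module.End.maxGenEigenspace (r.ρ φ) α ≠ ⊥ ∧
      ‖α‖ ^ 2 = (residueFieldCard F : ℝ) ^ (k + (j : ℝ))} := by
    have : {j : ℤ | ∃ α : ℂ, Module.End.maxGenEigenspace (r.ρ φ) α ≠ ⊥ ∧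
        ‖α‖ ^ 2 = (residueFieldCard F : ℝ) ^ (k + (j : ℝ))} ⊆
        ⋃ α ∈ {α : ℂ | Module.End.maxGenEigenspace (r.ρ φ) α ≠ ⊥},
          {j : ℤ | ‖α‖ ^ 2 = (residueFieldCard F : ℝ) ^ (k + (j : ℝ))} := by
      intro j hj
      obtain ⟨α, hα, hj⟩ := hj
      exact Set.mem_biUnion hα hj
    refine Set.Finite.subset (hfinE.biUnion fun α _ => Set.Subsingleton.finite ?_) this
    intro j hj j' hj'
    have e : (residueFieldCard F : ℝ) ^ (k + (j : ℝ)) =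
        (residueFieldCard F : ℝ) ^ (k + (j' : ℝ)) := by rw [← hj, ← hj']
    have e' : k + (j : ℝ) = k + (j' : ℝ) := le_antisymm
      ((Real.rpow_le_rpow_left_iff hq1).mp e.le) ((Real.rpow_le_rpow_left_iff hq1).mp e.ge)
    exact_mod_cast (add_left_cancel e')
  obtain ⟨M, hM⟩ := hfinJ.bddAbove
  have hbdd : ∀ j, M < j → ∀ x ∈ r.weightSpace φ k j, x = 0 := by
    intro j hj x hx
    have hWj : r.weightSpace φ k j ≤ ⊥ := by
      unfold weightSpace
      refine iSup₂_le fun α hα => ?_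
      by_contra hne
      have : j ≤ M := hM ⟨α, fun h0 => hne h0.le, hα⟩
      exact absurd hj (not_lt.mpr this)
    exact (Submodule.mem_bot ℂ).mp (hWj hx)
  -- apply the graded Lefschetz vanishing lemma
  have hvan : ∀ j, ∀ x ∈ r.weightSpace φ k j, f x = 0 := by
    refine gradedLefschetz_eq_zero (r.weightSpace φ k) r.N f hbdd ?_ ?_ ?_ ?_ ?_
    · intro j x hx
      have := r.map_weightSpace_le_of_comp_eq_smul_comp φ k hN hcN j ⟨x, hx, rfl⟩
      have e : j + (-2 : ℤ) = j - 2 := by ring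
      rw [e] at this; exact this
    · intro i x hx
      rw [← (hL i).1, Submodule.mem_map] at hx
      exact hx
    · exact fun i => (hL i).2
    · intro j x hx
      exact r.map_weightSpace_le_of_comp_eq_smul_comp φ k hf hcf j ⟨x, hx, rfl⟩
    · intro x
      exact congr($hfN x)
  -- conclude on `⊤ = ⨆ W j`
  ext x
  have hx : x ∈ ⨆ j, r.weightSpace φ k j := by rw [htop]; exact Submodule.mem_top
  rw [LinearMap.zero_apply]
  exact Submodule.iSup_induction (r.weightSpace φ k) (motive := fun x => f x = 0) hx hvan
    (map_zero f) (fun x y hx hy => by rw [map_add, hx, hy, add_zero])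

/-- **A pure `N` is equivalent to every generic `N'` on the same `(V, r)`** (`r`
Frobenius-semisimple, `V` finite-dimensional): by `IsPure.isGeneric` and the orbit theorem
`AHTW2026_prop_6_0_5_generic_conj_holds` (A'Campo–Hevesi–Thorne–Whitmore, Prop. 6.0.5: the
generic `N` form one `Aut(r)`-orbit).  This is the shape in which purity of one side settles a
comparison of monodromy operators once the Weil-group actions agree.
[cite: TaylorYoshida2007, Lemma 1.4 (4)] [cite: AHTW2026, Prop. 6.0.5 (1)–(2)] -/
theorem IsPure.isEquivalent_of_isGeneric {K : Type} [Field K] [ValuativeRel K]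
    [TopologicalSpace K] [IsNonarchimedeanLocalField K] {E : Type} [AddCommGroup E] [Module ℂ E]
    [FiniteDimensional ℂ E] {W W' : WeilDeligneRep K ℂ E} {φ : WeilGroup K} (hφ : deg φ = -1)
    {k : ℝ} (hW : W.IsPure φ k) (hss : W.IsFrobSemisimple) (hρ : W'.ρ = W.ρ)
    (hW' : W'.IsGeneric) : W.IsEquivalent W' :=
  AHTW2026_prop_6_0_5_generic_conj_holds.isEquivalent W W' hρ hss (hW.isGeneric hφ) hW'

/-- **Taylor–Yoshida, Lemma 1.4 (4)** (complex coefficients, `r` Frobenius-semisimple, `V`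
finite-dimensional): *given `(V, r)` there is, up to equivalence, at most one `N` which makes
`(V, r, N)` pure* — two pure monodromy operators for the same Weil-group action are conjugate
under `Aut(r)`.  Here via `IsPure.isGeneric` and the orbit theorem of A'Campo–Hevesi–Thorne–
Whitmore (Taylor–Yoshida argue directly with the decomposition `V = ⊕ N^j V(i)`).
[cite: TaylorYoshida2007, Lemma 1.4 (4)] -/
theorem IsPure.isEquivalent {K : Type} [Field K] [ValuativeRel K] [TopologicalSpace K]
    [IsNonarchimedeanLocalField K] {E : Type} [AddCommGroup E] [Module ℂ E]
    [FiniteDimensional ℂ E] {W W' : WeilDeligneRep K ℂ E} {φ : WeilGroup K} (hφ : deg φ = -1)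
    {k k' : ℝ} (hW : W.IsPure φ k) (hW' : W'.IsPure φ k') (hss : W.IsFrobSemisimple)
    (hρ : W'.ρ = W.ρ) : W.IsEquivalent W' :=
  hW.isEquivalent_of_isGeneric hφ hss hρ (hW'.isGeneric hφ)

end WeilDeligneRep

end Literature.NumberTheory.GaloisRepresentations

end
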